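import Mathlib
import Summits.Ventures.HodgeRepro2.Hypothesis
import Summits.Ventures.HodgeRepro2.DefiniteUnitaryBounded

/-!
# Discreteness of the integral unitary group at the indefinite place

Shimura's Theorem 8.1 (J. Math. Soc. Japan 31 (1979), §4 (4.14), §8) and Dimitrov–Ramakrishnan
(Doc. Math. 20 (2015), §1–§2) work with the arithmetic group `Γ_1 = U(L)_𝓞` (resp. `Γ_N`) acting on
the complex 2-ball through the one indefinite place `τ₁` of a hermitian form `H` over the CM field
`K` which is DEFINITE at every other place.  The printed inputs take for granted that this action is
properly discontinuous, i.e. that the image of `Γ_1` in `U(2,1)` is a DISCRETE subgroup.  This file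
kernel-checks that input on the shapes of `Hypothesis.lean` (gen-0 file, p385637), on top of the
definite-place bounds of `DefiniteUnitaryBounded.lean`:

* `finite_integralUnitaryGroup_of_forall_norm_le` — **the main statement**: for `H` definite at every
  place `≠ τ₁, \bar τ₁`, the elements of the integral unitary group `U(H)(𝓞_K)` whose `τ₁`-image has
  entries bounded by `C` form a FINITE set (all conjugates of every entry are bounded, the entries are
  algebraic integers: Mathlib's `NumberField.Embeddings.finite_of_norm_le`);
  `finite_principalCongruence_of_forall_norm_le` — the same for `Γ(𝔑) ⊆ U(L)_𝓞`;
* `isClosed_of_forall_finite_bounded` / `exists_isOpen_inter_eq_singleton_of_forall_finite_bounded` /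
  `discreteTopology_of_forall_finite_bounded` — a set of complex matrices meeting every entrywise
  bounded region in a finite set is closed and discrete (every point is isolated);
* `isClosed_image_map` / `discreteTopology_image_map` — the image `τ₁(U(H)(𝓞_K)) ⊆ M_m(ℂ)` is closed
  and discrete; `isClosed_image_realEmbedding` / `discreteTopology_image_realEmbedding` /
  `discreteTopology_image_realEmbedding_of_isPicardSignature` — the same for the image under a frame,
  `realEmbedding K τ₁ Q γ = Q τ₁(γ) Q⁻¹ ∈ U(2,1)` (`IsFrame.isInU21_realEmbedding`, BallActionU21
  p395073).

Nothing here is automorphic: together with `DefiniteUnitaryBounded.lean` this is the linear-algebra /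
algebraic-integer half of «`Γ_1` is a discrete subgroup of `U(2,1)`»; cocompactness (the anisotropy of
`H` over `K`) stays prose.
-/

open Matrix NumberField
open scoped ComplexOrder

namespace Summit.Ventures.HodgeRepro2.ShimuraData

section CMField

variable {K : Type*} [Field K] [NumberField K] [NumberField.IsCMField K]

/-- **Finiteness of bounded subsets of the integral unitary group.**  Let `H` be a Hermitian form
over the CM field `K`, definite at every place other than the place of `τ₁`.  Then the elements
`γ ∈ U(H)(𝓞_K)` whose image `τ₁(γ)` has all entries of absolute value `≤ C` form a finite set.
(Every entry is an algebraic integer all of whose conjugates are bounded — by `C` at `τ₁` and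
`\bar τ₁`, by the definite-place constants elsewhere — so it lies in the finite set of
`NumberField.Embeddings.finite_of_norm_le`.) -/
theorem finite_integralUnitaryGroup_of_forall_norm_le {m : ℕ} {H : Matrix (Fin m) (Fin m) K}
    (hH : IsHermitianForm K H) (τ₁ : K →+* ℂ)
    (hdef : ∀ τ : K →+* ℂ, InfinitePlace.mk τ ≠ InfinitePlace.mk τ₁ → IsDefiniteAt K τ H)
    (C : ℝ) :
    {γ : GL (Fin m) K | γ ∈ integralUnitaryGroup K H ∧
      ∀ i j, ‖((γ : Matrix (Fin m) (Fin m) K).map τ₁) i j‖ ≤ C}.Finite := by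
  classical
  -- a bound at every place
  have hb : ∀ τ : K →+* ℂ, ∃ c : ℝ, InfinitePlace.mk τ ≠ InfinitePlace.mk τ₁ →
      ∀ γ ∈ unitaryGroup K H, ∀ i j, ‖((γ : Matrix (Fin m) (Fin m) K).map τ) i j‖ ≤ c := by
    intro τ
    by_cases hτ : InfinitePlace.mk τ = InfinitePlace.mk τ₁
    · exact ⟨0, fun h => absurd hτ h⟩
    · obtain ⟨c, hc⟩ := exists_entry_bound_of_isDefiniteAt hH (hdef τ hτ)
      exact ⟨c, fun _ => hc⟩
  choose c hc using hb
  set B : ℝ := |C| + ∑ τ : K →+* ℂ, |c τ| with hBdef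
  have hCB : C ≤ B := by
    have : 0 ≤ ∑ τ : K →+* ℂ, |c τ| := Finset.sum_nonneg fun _ _ => abs_nonneg _
    linarith [le_abs_self C]
  have hcB : ∀ τ, c τ ≤ B := fun τ => by
    have : |c τ| ≤ ∑ τ' : K →+* ℂ, |c τ'| :=
      Finset.single_le_sum (f := fun τ' => |c τ'|) (fun _ _ => abs_nonneg _) (Finset.mem_univ τ)
    linarith [le_abs_self (c τ), abs_nonneg C]
  -- the finite set of algebraic integers with all conjugates bounded by `B`
  have hS := NumberField.Embeddings.finite_of_norm_le K ℂ B
  set S : Set K := {x : K | IsIntegral ℤ x ∧ ∀ φ : K →+* ℂ, ‖φ x‖ ≤ B} with hSdef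
  -- matrices with all entries in `S` form a finite set
  have hT : (Set.univ.pi fun _ : Fin m => Set.univ.pi fun _ : Fin m => S).Finite :=
    Set.Finite.pi fun _ => Set.Finite.pi fun _ => hS
  -- our set is the preimage of that set under the injective coercion `GL → Matrix`
  refine (hT.preimage (f := fun γ : GL (Fin m) K => (γ : Matrix (Fin m) (Fin m) K))
    (Units.val_injective.injOn)).subset ?_
  rintro γ ⟨⟨hγU, hγint, -⟩, hγC⟩
  refine Set.mem_univ_pi.mpr fun i => Set.mem_univ_pi.mpr fun j => ?_
  refine ⟨hγint i j, fun φ => ?_⟩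
  show ‖φ ((γ : Matrix (Fin m) (Fin m) K) i j)‖ ≤ B
  have hC1 : ‖τ₁ ((γ : Matrix (Fin m) (Fin m) K) i j)‖ ≤ C := by
    have := hγC i j
    rwa [Matrix.map_apply] at this
  by_cases hφ : InfinitePlace.mk φ = InfinitePlace.mk τ₁
  · -- `φ = τ₁` or `φ = \bar τ₁`: the bound `C`
    rcases InfinitePlace.mk_eq_iff.mp hφ with hφeq | hconj
    · rw [hφeq]; exact hC1.trans hCB
    · have e : ‖τ₁ ((γ : Matrix (Fin m) (Fin m) K) i j)‖ =
          ‖φ ((γ : Matrix (Fin m) (Fin m) K) i j)‖ := by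
        rw [← hconj, ComplexEmbedding.conjugate_coe_eq, Complex.norm_conj]
      rw [← e]; exact hC1.trans hCB
  · -- a definite place: the bound `c φ`
    have := hc φ hφ γ hγU i j
    rw [Matrix.map_apply] at this
    exact this.trans (hcB φ)

/-- The same finiteness for the principal congruence subgroups `Γ(𝔑) ⊆ U(L)_𝓞`. -/
theorem finite_principalCongruence_of_forall_norm_le {m : ℕ} {H : Matrix (Fin m) (Fin m) K}
    (hH : IsHermitianForm K H) (τ₁ : K →+* ℂ)
    (hdef : ∀ τ : K →+* ℂ, InfinitePlace.mk τ ≠ InfinitePlace.mk τ₁ → IsDefiniteAt K τ H)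
    (𝔑 : Ideal (RingOfIntegers K)) (C : ℝ) :
    {γ : GL (Fin m) K | γ ∈ principalCongruence K H 𝔑 ∧
      ∀ i j, ‖((γ : Matrix (Fin m) (Fin m) K).map τ₁) i j‖ ≤ C}.Finite :=
  (finite_integralUnitaryGroup_of_forall_norm_le hH τ₁ hdef C).subset
    fun _ ⟨hγ, hC⟩ => ⟨hγ.1, hC⟩

/-- The finiteness statement for the IMAGE `τ₁(U(H)(𝓞_K)) ⊆ M_m(ℂ)`: its intersection with every
entrywise bounded region is finite. -/
theorem finite_image_map_of_forall_norm_le {m : ℕ} {H : Matrix (Fin m) (Fin m) K}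
    (hH : IsHermitianForm K H) (τ₁ : K →+* ℂ)
    (hdef : ∀ τ : K →+* ℂ, InfinitePlace.mk τ ≠ InfinitePlace.mk τ₁ → IsDefiniteAt K τ H)
    (C : ℝ) :
    {M ∈ (fun γ : GL (Fin m) K => (γ : Matrix (Fin m) (Fin m) K).map τ₁) ''
        integralUnitaryGroup K H | ∀ i j, ‖M i j‖ ≤ C}.Finite := by
  refine ((finite_integralUnitaryGroup_of_forall_norm_le hH τ₁ hdef C).image
    fun γ : GL (Fin m) K => (γ : Matrix (Fin m) (Fin m) K).map τ₁).subset ?_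
  rintro M ⟨⟨γ, hγ, rfl⟩, hM⟩
  exact ⟨γ, ⟨hγ, hM⟩, rfl⟩

end CMField

/-! ### Closed and discrete subsets of `M_m(ℂ)` -/

/-- The entrywise open box `{M | ∀ i j, ‖M i j - x i j‖ < ε}` is open in `M_m(ℂ)`. -/
theorem isOpen_entryBox {m : ℕ} (x : Matrix (Fin m) (Fin m) ℂ) (ε : ℝ) :
    IsOpen {M : Matrix (Fin m) (Fin m) ℂ | ∀ i j, ‖M i j - x i j‖ < ε} := by
  have : {M : Matrix (Fin m) (Fin m) ℂ | ∀ i j, ‖M i j - x i j‖ < ε} =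
      ⋂ i, ⋂ j, (fun M : Matrix (Fin m) (Fin m) ℂ => M i j) ⁻¹' Metric.ball (x i j) ε := by
    ext M
    simp only [Set.mem_setOf_eq, Set.mem_iInter, Set.mem_preimage, Metric.mem_ball, dist_eq_norm]
  rw [this]
  exact isOpen_iInter_of_finite fun i => isOpen_iInter_of_finite fun j =>
    Metric.isOpen_ball.preimage (continuous_id.matrix_elem i j)

/-- A set of complex matrices meeting every entrywise bounded region in a finite set is closed. -/
theorem isClosed_of_forall_finite_bounded {m : ℕ} {S : Set (Matrix (Fin m) (Fin m) ℂ)}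
    (h : ∀ r : ℝ, {M ∈ S | ∀ i j, ‖M i j‖ ≤ r}.Finite) : IsClosed S := by
  rw [← isOpen_compl_iff, isOpen_iff_forall_mem_open]
  intro x hx
  set r : ℝ := entrySum x + 1 with hr
  have hF := h r
  refine ⟨{M | ∀ i j, ‖M i j - x i j‖ < 1} \ {M ∈ S | ∀ i j, ‖M i j‖ ≤ r}, ?_,
    (isOpen_entryBox x 1).sdiff hF.isClosed, ?_⟩
  · rintro M ⟨hMbox, hMF⟩ hMS
    refine hMF ⟨hMS, fun i j => ?_⟩
    calc ‖M i j‖ = ‖(M i j - x i j) + x i j‖ := by rw [sub_add_cancel]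
      _ ≤ ‖M i j - x i j‖ + ‖x i j‖ := norm_add_le _ _
      _ ≤ 1 + entrySum x := add_le_add (hMbox i j).le (norm_apply_le_entrySum x i j)
      _ = r := by rw [hr, add_comm]
  · refine ⟨fun i j => by simp, fun hxF => hx hxF.1⟩

/-- A set of complex matrices meeting every entrywise bounded region in a finite set is discrete:
every point has an open neighbourhood meeting the set in that point only. -/
theorem exists_isOpen_inter_eq_singleton_of_forall_finite_bounded {m : ℕ}
    {S : Set (Matrix (Fin m) (Fin m) ℂ)} (h : ∀ r : ℝ, {M ∈ S | ∀ i j, ‖M i j‖ ≤ r}.Finite)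
    {x : Matrix (Fin m) (Fin m) ℂ} (hx : x ∈ S) :
    ∃ U : Set (Matrix (Fin m) (Fin m) ℂ), IsOpen U ∧ U ∩ S = {x} := by
  set r : ℝ := entrySum x + 1 with hr
  have hF := h r
  refine ⟨{M | ∀ i j, ‖M i j - x i j‖ < 1} \ ({M ∈ S | ∀ i j, ‖M i j‖ ≤ r} \ {x}),
    (isOpen_entryBox x 1).sdiff (hF.subset Set.sdiff_subset).isClosed, ?_⟩
  ext M
  constructor
  · rintro ⟨⟨hMbox, hMF⟩, hMS⟩
    by_contra hMx
    refine hMF ⟨⟨hMS, fun i j => ?_⟩, hMx⟩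
    calc ‖M i j‖ = ‖(M i j - x i j) + x i j‖ := by rw [sub_add_cancel]
      _ ≤ ‖M i j - x i j‖ + ‖x i j‖ := norm_add_le _ _
      _ ≤ 1 + entrySum x := add_le_add (hMbox i j).le (norm_apply_le_entrySum x i j)
      _ = r := by rw [hr, add_comm]
  · rintro rfl
    exact ⟨⟨fun i j => by simp, fun hxF => hxF.2 rfl⟩, hx⟩

/-- A set of complex matrices meeting every entrywise bounded region in a finite set carries the
discrete topology. -/
theorem discreteTopology_of_forall_finite_bounded {m : ℕ} {S : Set (Matrix (Fin m) (Fin m) ℂ)}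
    (h : ∀ r : ℝ, {M ∈ S | ∀ i j, ‖M i j‖ ≤ r}.Finite) : DiscreteTopology S := by
  rw [discreteTopology_iff_isOpen_singleton]
  rintro ⟨x, hx⟩
  obtain ⟨U, hU, hUS⟩ := exists_isOpen_inter_eq_singleton_of_forall_finite_bounded h hx
  rw [isOpen_induced_iff]
  refine ⟨U, hU, ?_⟩
  ext ⟨y, hy⟩
  simp only [Set.mem_preimage, Set.mem_singleton_iff, Subtype.mk.injEq]
  constructor
  · intro hyU
    have : y ∈ U ∩ S := ⟨hyU, hy⟩
    rw [hUS] at this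
    exact this
  · intro hyx
    rw [hyx]
    have hxU : x ∈ U ∩ S := by rw [hUS]; exact Set.mem_singleton x
    exact hxU.1

section CMField

variable {K : Type*} [Field K] [NumberField K] [NumberField.IsCMField K]

/-- **The image `τ₁(U(H)(𝓞_K)) ⊆ M_m(ℂ)` is closed.** -/
theorem isClosed_image_map {m : ℕ} {H : Matrix (Fin m) (Fin m) K}
    (hH : IsHermitianForm K H) (τ₁ : K →+* ℂ)
    (hdef : ∀ τ : K →+* ℂ, InfinitePlace.mk τ ≠ InfinitePlace.mk τ₁ → IsDefiniteAt K τ H) :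
    IsClosed ((fun γ : GL (Fin m) K => (γ : Matrix (Fin m) (Fin m) K).map τ₁) ''
      integralUnitaryGroup K H) :=
  isClosed_of_forall_finite_bounded (finite_image_map_of_forall_norm_le hH τ₁ hdef)

/-- **The image `τ₁(U(H)(𝓞_K)) ⊆ M_m(ℂ)` is discrete.** -/
theorem discreteTopology_image_map {m : ℕ} {H : Matrix (Fin m) (Fin m) K}
    (hH : IsHermitianForm K H) (τ₁ : K →+* ℂ)
    (hdef : ∀ τ : K →+* ℂ, InfinitePlace.mk τ ≠ InfinitePlace.mk τ₁ → IsDefiniteAt K τ H) :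
    DiscreteTopology ((fun γ : GL (Fin m) K => (γ : Matrix (Fin m) (Fin m) K).map τ₁) ''
      integralUnitaryGroup K H) :=
  discreteTopology_of_forall_finite_bounded (finite_image_map_of_forall_norm_le hH τ₁ hdef)

omit [NumberField K] [NumberField.IsCMField K] in
/-- Through a frame `Q` (`IsFrame K τ₁ H Q`, so `Q` is invertible), an entrywise bound on
`realEmbedding K τ₁ Q γ = Q τ₁(γ) Q⁻¹` gives an entrywise bound on `τ₁(γ)`. -/
theorem norm_map_apply_le_of_realEmbedding_le {τ₁ : K →+* ℂ} {H : Matrix (Fin 3) (Fin 3) K}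
    {Q : Matrix (Fin 3) (Fin 3) ℂ} (hQ : IsFrame K τ₁ H Q) (γ : GL (Fin 3) K) {r : ℝ}
    (hr : ∀ i j, ‖realEmbedding K τ₁ Q γ i j‖ ≤ r) (i j : Fin 3) :
    ‖((γ : Matrix (Fin 3) (Fin 3) K).map τ₁) i j‖ ≤
      (3 * 3 : ℝ) * (entrySum Q⁻¹ * ((3 * 3 : ℝ) * r)) * entrySum Q := by
  have hdet : IsUnit Q.det := hQ.2
  have e : (γ : Matrix (Fin 3) (Fin 3) K).map τ₁ = Q⁻¹ * realEmbedding K τ₁ Q γ * Q := by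
    unfold realEmbedding
    rw [Matrix.mul_assoc Q, Matrix.nonsing_inv_mul_cancel_left _ _ hdet,
      Matrix.nonsing_inv_mul_cancel_right _ _ hdet]
  rw [e]
  simpa using norm_mul_mul_apply_le Q⁻¹ (realEmbedding K τ₁ Q γ) Q hr i j

/-- Bounded subsets of the frame image `realEmbedding K τ₁ Q (U(H)(𝓞_K)) ⊆ U(2,1)` are finite. -/
theorem finite_image_realEmbedding_of_forall_norm_le {τ₁ : K →+* ℂ} {H : Matrix (Fin 3) (Fin 3) K}
    (hH : IsHermitianForm K H)
    (hdef : ∀ τ : K →+* ℂ, InfinitePlace.mk τ ≠ InfinitePlace.mk τ₁ → IsDefiniteAt K τ H)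
    {Q : Matrix (Fin 3) (Fin 3) ℂ} (hQ : IsFrame K τ₁ H Q) (C : ℝ) :
    {M ∈ realEmbedding K τ₁ Q '' integralUnitaryGroup K H | ∀ i j, ‖M i j‖ ≤ C}.Finite := by
  refine ((finite_integralUnitaryGroup_of_forall_norm_le hH τ₁ hdef
    ((3 * 3 : ℝ) * (entrySum Q⁻¹ * ((3 * 3 : ℝ) * C)) * entrySum Q)).image
    (realEmbedding K τ₁ Q)).subset ?_
  rintro M ⟨⟨γ, hγ, rfl⟩, hM⟩
  exact ⟨γ, ⟨hγ, norm_map_apply_le_of_realEmbedding_le hQ γ hM⟩, rfl⟩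

/-- **The frame image `Q τ₁(U(H)(𝓞_K)) Q⁻¹ ⊆ M_3(ℂ)` is closed.** -/
theorem isClosed_image_realEmbedding {τ₁ : K →+* ℂ} {H : Matrix (Fin 3) (Fin 3) K}
    (hH : IsHermitianForm K H)
    (hdef : ∀ τ : K →+* ℂ, InfinitePlace.mk τ ≠ InfinitePlace.mk τ₁ → IsDefiniteAt K τ H)
    {Q : Matrix (Fin 3) (Fin 3) ℂ} (hQ : IsFrame K τ₁ H Q) :
    IsClosed (realEmbedding K τ₁ Q '' integralUnitaryGroup K H) :=
  isClosed_of_forall_finite_bounded (finite_image_realEmbedding_of_forall_norm_le hH hdef hQ)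

/-- **The frame image `Q τ₁(U(H)(𝓞_K)) Q⁻¹ ⊆ U(2,1)` is discrete.**  Together with
`IsFrame.isInU21_realEmbedding` (BallActionU21, p395073) this is the statement «`Γ_1` embeds as a
discrete subgroup of `U(2,1)`» behind Shimura's Theorem 8.1 / DR15 §2. -/
theorem discreteTopology_image_realEmbedding {τ₁ : K →+* ℂ} {H : Matrix (Fin 3) (Fin 3) K}
    (hH : IsHermitianForm K H)
    (hdef : ∀ τ : K →+* ℂ, InfinitePlace.mk τ ≠ InfinitePlace.mk τ₁ → IsDefiniteAt K τ H)
    {Q : Matrix (Fin 3) (Fin 3) ℂ} (hQ : IsFrame K τ₁ H Q) :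
    DiscreteTopology (realEmbedding K τ₁ Q '' integralUnitaryGroup K H) :=
  discreteTopology_of_forall_finite_bounded (finite_image_realEmbedding_of_forall_norm_le hH hdef hQ)

omit [NumberField K] [NumberField.IsCMField K] in
/-- The definiteness hypothesis is the second half of `IsPicardSignature`. -/
theorem IsPicardSignature.isDefiniteAt_of_ne {n : ℕ} {τ₁ : K →+* ℂ}
    {H : Matrix (Fin (n + 1)) (Fin (n + 1)) K} (hP : IsPicardSignature K τ₁ H) :
    ∀ τ : K →+* ℂ, InfinitePlace.mk τ ≠ InfinitePlace.mk τ₁ → IsDefiniteAt K τ H :=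
  hP.2

/-- For a Picard signature `(2,1)` at `τ₁` and a frame `Q`, the image of `U(H)(𝓞_K)` in `U(2,1)` is
discrete. -/
theorem discreteTopology_image_realEmbedding_of_isPicardSignature {τ₁ : K →+* ℂ}
    {H : Matrix (Fin 3) (Fin 3) K} (hH : IsHermitianForm K H) (hP : IsPicardSignature K τ₁ H)
    {Q : Matrix (Fin 3) (Fin 3) ℂ} (hQ : IsFrame K τ₁ H Q) :
    DiscreteTopology (realEmbedding K τ₁ Q '' integralUnitaryGroup K H) :=
  discreteTopology_image_realEmbedding hH hP.isDefiniteAt_of_ne hQ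

end CMField

end Summit.Ventures.HodgeRepro2.ShimuraData
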